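import Mathlib
import Summits.CriticalPhenomena.CardyFormulaZ2.Theorems.CardySelfRefinementDefs
import Literature.Probability.Percolation.QuadCrossingPushforward
import HarnessLib

/-!
# The self-refinement model `M_k(ρ,c)`: honest probability measure, support, localisation

Support file for item `RussoDrift` (stmt-CriticalPhenomena-10271) of route `CardySelfRefinement`
(sub-problem `CriticalPhenomena/CardyFormulaZ2`), vocabulary from `CardySelfRefinementDefs`.
Adapted from the checked disproof work file `Cruxes/GradientComparability/Disproof.lean` §4–§5d
(refuter-cdisprove gen 2), whose §1 abbreviations are the ones of `CardySelfRefinementDefs`.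

* `measurable_cfg`, `isProbabilityMeasure_M` — the read-out `cfg k` is measurable, so `M k ρ c`
  is an honest push-forward probability measure; `P_nonneg`, `P_le_one`, `P_zero` (empty family:
  `P ≡ 1`).
* `nnSupport` has full mass (`M_nnSupport`), so every set has the mass of its trace
  (`M_eq_inter_nnSupport`, `P_eq_inter_nnSupport`).
* Localisation: the crossing of a quad in the closure sense of `configOf` is decided by the pairs
  drawn through the `1`-thickening of its carrier (`mem_configOf_iff_of_sandwich`); for `η ≠ 0`
  these are finitely many nearest-neighbour edges (`edgesNear_finite`, `window_finite`); hence on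
  `nnSupport` the joint crossing event is the finite cylinder `Aloc` (`mem_A_iff_inter_window`,
  `measurableSet_Aloc`) and `P k m F η ρ c = (M k ρ c).real (Aloc m F η)` (`P_eq_real_Aloc`).
-/

noncomputable section

namespace Summit.CriticalPhenomena.CardyFormulaZ2.Theorems.CardySelfRefinement

open scoped Topology BigOperators Classical ProbabilityTheory
open Filter Set MeasureTheory Function TopologicalSpace
open Literature.Probability.LatticeModels Literature.Probability.Percolation
open Literature.Probability.Percolation.QuadCrossing
open Summit.CriticalPhenomena.CardyFormulaZ2.Theses.CardySelfRefinement

/-! ## The law `M_k(ρ,c)` is an honest probability measure -/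

-- adapted from Cruxes/GradientComparability/Disproof.lean §4 (refuter-cdisprove gen 2)
/-- The coin-to-edge read-out `cfg k` is measurable, so `M k ρ c` is the honest push-forward (no
`Measure.map` junk value) and a probability measure. -/
theorem measurable_cfg (k : ℕ) : Measurable (cfg k) := by
  refine measurable_set_iff.2 fun e => ?_
  refine measurableSet_setOf.1 ?_
  change MeasurableSet {S : Set (Site 2 × Fin 2 × Fin 3) |
    ∃ (v : Site 2) (d : Fin 2), e = s(v, v + (if d = 0 then ![1, 0] else ![0, 1])) ∧ opn k S (v, d)}
  have hopn : ∀ (v : Site 2) (d : Fin 2),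
      MeasurableSet {S : Set (Site 2 × Fin 2 × Fin 3) | opn k S (v, d)} := by
    intro v d
    by_cases hax : ax k (v, d)
    · simp only [opn, hax, if_true, Set.setOf_or, Set.setOf_and]
      exact ((measurableSet_mem _).inter (measurableSet_mem _)).union
        ((measurableSet_notMem _).inter (measurableSet_mem _))
    · simp only [opn, hax, if_false]
      exact measurableSet_mem _
  have : {S : Set (Site 2 × Fin 2 × Fin 3) |
      ∃ (v : Site 2) (d : Fin 2), e = s(v, v + (if d = 0 then ![1, 0] else ![0, 1])) ∧ opn k S (v, d)} =
      ⋃ (v : Site 2) (d : Fin 2),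
        ({S | e = s(v, v + (if d = 0 then ![1, 0] else ![0, 1]))} ∩ {S | opn k S (v, d)}) := by
    ext S; simp only [Set.mem_setOf_eq, Set.mem_iUnion, Set.mem_inter_iff]
  rw [this]
  exact MeasurableSet.iUnion fun v => MeasurableSet.iUnion fun d =>
    (MeasurableSet.const _).inter (hopn v d)

/-- `M k ρ c` is a probability measure (stated as a theorem; use `haveI` at call sites). -/
theorem isProbabilityMeasure_M (k : ℕ) (ρ c : ℝ) : IsProbabilityMeasure (M k ρ c) :=
  Measure.isProbabilityMeasure_map (measurable_cfg k).aemeasurable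

/-- `0 ≤ P`. -/
theorem P_nonneg (k m : ℕ) (F : Fin m → Quad (Set.univ : Set ℂ)) (η ρ c : ℝ) :
    0 ≤ P k m F η ρ c := measureReal_nonneg

/-- `P ≤ 1`. -/
theorem P_le_one (k m : ℕ) (F : Fin m → Quad (Set.univ : Set ℂ)) (η ρ c : ℝ) :
    P k m F η ρ c ≤ 1 := by
  haveI := isProbabilityMeasure_M k ρ c
  have h : (M k ρ c).real (A m F η) ≤ (M k ρ c).real Set.univ :=
    measureReal_mono (Set.subset_univ _) (measure_ne_top _ _)
  rwa [probReal_univ] at h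

/-- With the EMPTY quad family the joint crossing event is everything … -/
theorem A_zero (F : Fin 0 → Quad (Set.univ : Set ℂ)) (η : ℝ) : A 0 F η = Set.univ :=
  Set.eq_univ_of_forall fun _ i => i.elim0

/-- … and its probability is identically `1`. -/
theorem P_zero (k : ℕ) (F : Fin 0 → Quad (Set.univ : Set ℂ)) (η ρ c : ℝ) : P k 0 F η ρ c = 1 := by
  haveI := isProbabilityMeasure_M k ρ c
  simp only [P, A_zero, probReal_univ]

/-! ## Support: only nearest-neighbour edges are ever open -/

-- adapted from Cruxes/GradientComparability/Disproof.lean §5b–§5c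
/-- The plane realisation of open edges is monotone in the configuration. -/
theorem openEdgeRealization_mono' {V : Type*} (z : V → ℂ) (δ : ℝ) {ω ω' : BondConfig V}
    (h : ω ⊆ ω') : openEdgeRealization z δ ω ⊆ openEdgeRealization z δ ω' := by
  rintro w ⟨x, y, hxy, hw⟩
  exact ⟨x, y, h hxy, hw⟩

/-- The direction vector is a unit coordinate vector. -/
theorem dirVec_eq_single (d : Fin 2) :
    ((if d = 0 then ![1, 0] else ![0, 1]) : Site 2) = Pi.single d 1 := by
  fin_cases d <;> (ext i; fin_cases i <;> simp)

/-- The read-out only ever opens nearest-neighbour edges of `ℤ²`. -/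
theorem cfg_subset_edgeSet (k : ℕ) (S : Set (Site 2 × Fin 2 × Fin 3)) :
    cfg k S ⊆ (zdGraph 2).edgeSet := by
  rintro e ⟨v, d, rfl, -⟩
  rw [SimpleGraph.mem_edgeSet]
  exact (zdGraph_adj_iff _ _).2 ⟨d, Or.inl (by rw [dirVec_eq_single])⟩

/-- `nnSupport` is measurable. -/
theorem measurableSet_nnSupport : MeasurableSet nnSupport := by
  have : nnSupport = ⋂ (x : Site 2) (y : Site 2),
      {ω : BondConfig (Site 2) | s(x, y) ∈ ω → (zdGraph 2).Adj x y} := by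
    ext ω
    simp only [nnSupport, Set.mem_setOf_eq, Set.mem_iInter]
    constructor
    · intro h x y hxy
      exact (SimpleGraph.mem_edgeSet _).1 (h hxy)
    · intro h e he
      induction e using Sym2.ind with
      | h x y => exact (SimpleGraph.mem_edgeSet _).2 (h x y he)
  rw [this]
  refine MeasurableSet.iInter fun x => MeasurableSet.iInter fun y => ?_
  by_cases hadj : (zdGraph 2).Adj x y
  · simp only [hadj, imp_true_iff, Set.setOf_true]
    exact MeasurableSet.univ
  · simp only [hadj, imp_false]
    exact measurableSet_notMem _

/-- `M_k(ρ,c)` gives full mass to `nnSupport`. -/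
theorem M_nnSupport (k : ℕ) (ρ c : ℝ) : M k ρ c nnSupport = 1 := by
  simp only [M]
  rw [Measure.map_apply (measurable_cfg k) measurableSet_nnSupport]
  have : cfg k ⁻¹' nnSupport = Set.univ :=
    Set.eq_univ_of_forall fun S => cfg_subset_edgeSet k S
  rw [this, measure_univ]

/-- The complement of `nnSupport` is `M_k(ρ,c)`-null. -/
theorem M_compl_nnSupport (k : ℕ) (ρ c : ℝ) : M k ρ c nnSupportᶜ = 0 := by
  haveI := isProbabilityMeasure_M k ρ c
  exact (prob_compl_eq_zero_iff measurableSet_nnSupport).2 (M_nnSupport k ρ c)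

/-- Every set (measurable or not) has the `M_k(ρ,c)`-mass of its trace on `nnSupport`. -/
theorem M_eq_inter_nnSupport (k : ℕ) (ρ c : ℝ) (E : Set (BondConfig (Site 2))) :
    M k ρ c E = M k ρ c (E ∩ nnSupport) := by
  have h := measure_inter_add_sdiff₀ (μ := M k ρ c) E measurableSet_nnSupport.nullMeasurableSet
  have h0 : M k ρ c (E \ nnSupport) = 0 :=
    measure_mono_null (Set.sdiff_subset_compl _ _) (M_compl_nnSupport k ρ c)
  rw [h0, add_zero] at h
  exact h.symm

/-- `P` is the mass of the trace of `A` on `nnSupport`. -/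
theorem P_eq_inter_nnSupport (k m : ℕ) (F : Fin m → Quad (Set.univ : Set ℂ)) (η ρ c : ℝ) :
    P k m F η ρ c = (M k ρ c).real (A m F η ∩ nnSupport) := by
  simp only [P, Measure.real, M_eq_inter_nnSupport k ρ c (A m F η)]

/-! ## Localisation: the crossing event of a quad depends only on the edges drawn near `[Q]` -/

-- adapted from Cruxes/GradientComparability/Disproof.lean §5d
/-- Only the pairs drawn through `B` matter for the part of the realisation inside `B`. -/
theorem openEdgeRealization_inter_subset (η : ℝ) (B : Set ℂ) (ω : BondConfig (Site 2)) :
    openEdgeRealization squareLatticeEmbedding.z η ω ∩ B ⊆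
      openEdgeRealization squareLatticeEmbedding.z η (ω ∩ pairsNear η B) := by
  rintro w ⟨⟨x, y, hxy, hw⟩, hwB⟩
  exact ⟨x, y, ⟨hxy, x, y, rfl, w, hw, hwB⟩, hw⟩

/-- Quads at uniform distance `< 1` from `Q` have their carrier in the `1`-thickening of `[Q]`. -/
theorem carrier_subset_thickening {Q Q' : Quad (Set.univ : Set ℂ)} (h : dist Q' Q < 1) :
    Q'.carrier ⊆ Metric.thickening 1 Q.carrier := by
  rintro w ⟨z, rfl⟩
  exact Metric.mem_thickening_iff.2 ⟨Q z, ⟨z, rfl⟩, lt_of_le_of_lt (Quad.dist_apply_le Q' Q z) h⟩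

/-- **Localisation (sandwich form).** If `ω'` lies between `ω ∩ pairsNear η (thickening 1 [Q])`
and `ω`, then `Q` is crossed (in the `configOf` = closure sense) by `ω` iff by `ω'`. -/
theorem mem_configOf_iff_of_sandwich (η : ℝ) (Q : Quad (Set.univ : Set ℂ)) {ω ω' : BondConfig (Site 2)}
    (h₁ : ω ∩ pairsNear η (Metric.thickening 1 Q.carrier) ⊆ ω') (h₂ : ω' ⊆ ω) :
    Q ∈ configOf squareLatticeEmbedding.z η Set.univ ω ↔
      Q ∈ configOf squareLatticeEmbedding.z η Set.univ ω' := by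
  constructor
  · intro hQ
    change Q ∈ closure (rawCrossedSet (openEdgeRealization squareLatticeEmbedding.z η ω)
      (Set.univ : Set ℂ)) at hQ
    change Q ∈ closure (rawCrossedSet (openEdgeRealization squareLatticeEmbedding.z η ω')
      (Set.univ : Set ℂ))
    rw [Metric.mem_closure_iff] at hQ ⊢
    intro ε hε
    obtain ⟨Q', hQ'raw, hQ'd⟩ := hQ (min ε 1) (lt_min hε one_pos)
    refine ⟨Q', ?_, lt_of_lt_of_le hQ'd (min_le_left _ _)⟩
    obtain ⟨K, hK, hKω⟩ := hQ'raw
    refine ⟨K, hK, ?_⟩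
    have hKB : K ⊆ Metric.thickening 1 Q.carrier :=
      hK.2.2.1.trans (carrier_subset_thickening
        (by rw [dist_comm]; exact lt_of_lt_of_le hQ'd (min_le_right _ _)))
    exact ((Set.subset_inter hKω hKB).trans (openEdgeRealization_inter_subset η _ ω)).trans
      (openEdgeRealization_mono' _ η h₁)
  · intro hQ
    exact configOfSet_mono (D := (Set.univ : Set ℂ)) (openEdgeRealization_mono' _ η h₂) hQ

/-- Coordinates are bounded by the norm of the drawn site. -/
theorem abs_coord_le_norm_z (x : Site 2) (i : Fin 2) :
    |(x i : ℝ)| ≤ ‖squareLatticeEmbedding.z x‖ := by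
  have h1 : ‖squareLatticeEmbedding.z x‖ = Real.sqrt 2 * ‖Site.toComplex x‖ := by
    show ‖((Real.sqrt 2 : ℝ) : ℂ) * Site.toComplex x‖ = _
    rw [norm_mul, Complex.norm_real, Real.norm_of_nonneg (Real.sqrt_nonneg _)]
  have hsq : (1 : ℝ) ≤ Real.sqrt 2 := by
    rw [show (1 : ℝ) = Real.sqrt 1 by simp]
    exact Real.sqrt_le_sqrt (by norm_num)
  have h2 : ‖Site.toComplex x‖ ≤ ‖squareLatticeEmbedding.z x‖ := by
    rw [h1]; nlinarith [norm_nonneg (Site.toComplex x)]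
  have h3 : |(x i : ℝ)| ≤ ‖Site.toComplex x‖ := by
    fin_cases i
    · simpa using Complex.abs_re_le_norm (Site.toComplex x)
    · simpa using Complex.abs_im_le_norm (Site.toComplex x)
  exact h3.trans h2

/-- Adjacent sites differ by at most `1` in each coordinate. -/
theorem adj_coord_sub_abs_le {x y : Site 2} (h : (zdGraph 2).Adj x y) (i : Fin 2) :
    |(x i : ℝ) - (y i : ℝ)| ≤ 1 := by
  obtain ⟨j, hj | hj⟩ := (zdGraph_adj_iff x y).1 h
  · subst hj
    by_cases hij : i = j
    · subst hij; simp
    · simp [hij]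
  · subst hj
    by_cases hij : i = j
    · subst hij; simp
    · simp [hij]

/-- Adjacent sites are drawn at distance `≤ 2` (before scaling by `√2`). -/
theorem norm_toComplex_sub_le_of_adj {x y : Site 2} (h : (zdGraph 2).Adj x y) :
    ‖Site.toComplex x - Site.toComplex y‖ ≤ 2 := by
  have h0 := adj_coord_sub_abs_le h 0
  have h1 := adj_coord_sub_abs_le h 1
  have hre : (Site.toComplex x - Site.toComplex y).re = (x 0 : ℝ) - y 0 := by simp [Site.toComplex]
  have him : (Site.toComplex x - Site.toComplex y).im = (x 1 : ℝ) - y 1 := by simp [Site.toComplex]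
  calc ‖Site.toComplex x - Site.toComplex y‖
      ≤ |(Site.toComplex x - Site.toComplex y).re| + |(Site.toComplex x - Site.toComplex y).im| :=
        Complex.norm_le_abs_re_add_abs_im _
    _ ≤ 2 := by rw [hre, him]; linarith

/-- At mesh `η` adjacent sites are drawn at distance `≤ 2√2 |η|`. -/
theorem dist_z_le_of_adj {x y : Site 2} (h : (zdGraph 2).Adj x y) (η : ℝ) :
    dist ((η : ℂ) * squareLatticeEmbedding.z x) ((η : ℂ) * squareLatticeEmbedding.z y) ≤
      2 * Real.sqrt 2 * |η| := by
  rw [dist_eq_norm, ← mul_sub, norm_mul, Complex.norm_real, Real.norm_eq_abs]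
  have hz : squareLatticeEmbedding.z x - squareLatticeEmbedding.z y =
      ((Real.sqrt 2 : ℝ) : ℂ) * (Site.toComplex x - Site.toComplex y) := by
    show ((Real.sqrt 2 : ℝ) : ℂ) * Site.toComplex x - ((Real.sqrt 2 : ℝ) : ℂ) * Site.toComplex y = _
    ring
  rw [hz, norm_mul, Complex.norm_real, Real.norm_of_nonneg (Real.sqrt_nonneg _)]
  have := norm_toComplex_sub_le_of_adj h
  have hη := abs_nonneg η
  have hs := Real.sqrt_nonneg 2
  calc |η| * (Real.sqrt 2 * ‖Site.toComplex x - Site.toComplex y‖)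
      ≤ |η| * (Real.sqrt 2 * 2) := by gcongr
    _ = 2 * Real.sqrt 2 * |η| := by ring

/-- For `η ≠ 0`, only finitely many nearest-neighbour edges are drawn through a bounded set. -/
theorem edgesNear_finite {η : ℝ} (hη : η ≠ 0) {B : Set ℂ} (hB : Bornology.IsBounded B) :
    (edgesNear η B).Finite := by
  obtain ⟨R, hR⟩ := hB.subset_closedBall 0
  obtain ⟨N, hN⟩ : ∃ N : ℕ, max R 0 / |η| + 2 * Real.sqrt 2 ≤ N := exists_nat_ge _
  have hη' : 0 < |η| := abs_pos.2 hη
  have key : ∀ x y : Site 2, (zdGraph 2).Adj x y →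
      (segment ℝ ((η : ℂ) * squareLatticeEmbedding.z x) ((η : ℂ) * squareLatticeEmbedding.z y) ∩ B).Nonempty →
      x ∈ (box 2 N : Finset (Site 2)) := by
    intro x y hadj hne
    obtain ⟨w, hw, hwB⟩ := hne
    have hwR : ‖w‖ ≤ max R 0 := by
      have := hR hwB
      rw [Metric.mem_closedBall, dist_zero_right] at this
      exact this.trans (le_max_left _ _)
    have hseg := segment_subset_closedBall_left _ _ hw
    rw [Metric.mem_closedBall] at hseg
    have hdist := dist_z_le_of_adj hadj η
    have ha : ‖(η : ℂ) * squareLatticeEmbedding.z x‖ ≤ max R 0 + 2 * Real.sqrt 2 * |η| := by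
      have h1 : ‖(η : ℂ) * squareLatticeEmbedding.z x‖ ≤ ‖w‖ + ‖(η : ℂ) * squareLatticeEmbedding.z x - w‖ :=
        norm_le_norm_add_norm_sub' _ _
      rw [← dist_eq_norm, dist_comm] at h1
      linarith
    rw [norm_mul, Complex.norm_real, Real.norm_eq_abs] at ha
    have hz : ‖squareLatticeEmbedding.z x‖ ≤ N := by
      have : ‖squareLatticeEmbedding.z x‖ ≤ max R 0 / |η| + 2 * Real.sqrt 2 := by
        rw [div_add' _ _ _ hη'.ne', le_div_iff₀ hη']
        nlinarith
      exact this.trans hN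
    rw [mem_box]
    intro i
    have hi := (abs_coord_le_norm_z x i).trans hz
    rw [abs_le] at hi
    constructor
    · have : (((-(N : ℤ)) : ℤ) : ℝ) ≤ ((x i : ℤ) : ℝ) := by push_cast; linarith [hi.1]
      exact_mod_cast this
    · have : ((x i : ℤ) : ℝ) ≤ ((N : ℤ) : ℝ) := by push_cast; linarith [hi.2]
      exact_mod_cast this
  refine ((((box 2 N : Finset (Site 2)).finite_toSet.prod (box 2 N : Finset (Site 2)).finite_toSet).image
    fun p : Site 2 × Site 2 => s(p.1, p.2)).subset ?_)
  rintro e ⟨⟨x, y, rfl, hseg⟩, he⟩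
  have hadj : (zdGraph 2).Adj x y := (SimpleGraph.mem_edgeSet _).1 he
  refine ⟨(x, y), ⟨key x y hadj hseg, key y x hadj.symm ?_⟩, rfl⟩
  rwa [segment_symm]

/-- The window of the family `F` at mesh `η ≠ 0` is finite. -/
theorem window_finite (m : ℕ) (F : Fin m → Quad (Set.univ : Set ℂ)) {η : ℝ} (hη : η ≠ 0) :
    (window m F η).Finite :=
  Set.finite_iUnion fun i =>
    edgesNear_finite hη ((F i).isCompact_carrier.isBounded.thickening)

/-- **On `nnSupport` the joint crossing event is decided by the finite window.** -/
theorem mem_A_iff_inter_window {m : ℕ} (F : Fin m → Quad (Set.univ : Set ℂ)) (η : ℝ)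
    {ω : BondConfig (Site 2)} (hω : ω ∈ nnSupport) :
    ω ∈ A m F η ↔ ω ∩ window m F η ∈ A m F η := by
  refine forall_congr' fun i => mem_configOf_iff_of_sandwich η (F i) ?_ Set.inter_subset_left
  rintro e ⟨heω, hep⟩
  exact ⟨heω, Set.mem_iUnion.2 ⟨i, hep, hω heω⟩⟩

/-- The trace of `A` on `nnSupport` is the trace of the cylinder `Aloc`. -/
theorem A_inter_nnSupport_eq (m : ℕ) (F : Fin m → Quad (Set.univ : Set ℂ)) (η : ℝ) :
    A m F η ∩ nnSupport = Aloc m F η ∩ nnSupport := by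
  ext ω
  simp only [Set.mem_inter_iff, Aloc, Set.mem_setOf_eq]
  constructor
  · rintro ⟨hA, hω⟩; exact ⟨(mem_A_iff_inter_window F η hω).1 hA, hω⟩
  · rintro ⟨hA, hω⟩; exact ⟨(mem_A_iff_inter_window F η hω).2 hA, hω⟩

/-- Events decided by a finite set of coordinates are measurable (finite union of cylinders). -/
theorem measurableSet_setOf_inter_mem {W : Set (Sym2 (Site 2))} (hW : W.Finite)
    (E : Set (BondConfig (Site 2))) :
    MeasurableSet {ω : BondConfig (Site 2) | ω ∩ W ∈ E} := by
  have hrepr : {ω : BondConfig (Site 2) | ω ∩ W ∈ E} =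
      ⋃ T ∈ {T : Set (Sym2 (Site 2)) | T ⊆ W ∧ T ∈ E}, {ω | ω ∩ W = T} := by
    ext ω
    simp only [Set.mem_setOf_eq, Set.mem_iUnion, exists_prop]
    constructor
    · intro h; exact ⟨ω ∩ W, ⟨Set.inter_subset_right, h⟩, rfl⟩
    · rintro ⟨T, ⟨-, hT⟩, hωT⟩; rwa [hωT]
  rw [hrepr]
  refine Set.Finite.measurableSet_biUnion (hW.finite_subsets.subset fun T hT => hT.1) fun T hT => ?_
  have hTW : T ⊆ W := hT.1
  have hcyl : {ω : BondConfig (Site 2) | ω ∩ W = T} = ⋂ e ∈ W, {ω | e ∈ ω ↔ e ∈ T} := by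
    ext ω
    simp only [Set.mem_setOf_eq, Set.mem_iInter]
    constructor
    · intro h e he
      rw [← h]
      exact ⟨fun heω => ⟨heω, he⟩, fun h' => h'.1⟩
    · intro h
      ext e
      simp only [Set.mem_inter_iff]
      constructor
      · rintro ⟨heω, heW⟩; exact (h e heW).1 heω
      · intro heT; exact ⟨(h e (hTW heT)).2 heT, hTW heT⟩
  rw [hcyl]
  refine Set.Finite.measurableSet_biInter hW fun e _ => ?_
  by_cases heT : e ∈ T
  · simp only [heT, iff_true]
    exact measurableSet_mem e
  · simp only [heT, iff_false]
    exact measurableSet_notMem e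

/-- The cylinder `Aloc` is measurable (for `η ≠ 0`). -/
theorem measurableSet_Aloc (m : ℕ) (F : Fin m → Quad (Set.univ : Set ℂ)) {η : ℝ} (hη : η ≠ 0) :
    MeasurableSet (Aloc m F η) :=
  measurableSet_setOf_inter_mem (window_finite m F hη) _

/-- **`P` is the probability of the genuine finite-dimensional cylinder event `Aloc`.** -/
theorem P_eq_real_Aloc (k m : ℕ) (F : Fin m → Quad (Set.univ : Set ℂ)) (η ρ c : ℝ) :
    P k m F η ρ c = (M k ρ c).real (Aloc m F η) := by
  rw [P_eq_inter_nnSupport, A_inter_nnSupport_eq, Measure.real, Measure.real,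
    ← M_eq_inter_nnSupport]

end Summit.CriticalPhenomena.CardyFormulaZ2.Theorems.CardySelfRefinement

end
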